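import Literature.NumberTheory.LFunctions.ThornerZamanWeight
import HarnessLib

/-!
# A smooth window weight for short intervals and its Laplace transform

Topic `Literature/NumberTheory/LFunctions`, sub-namespace `WindowWeight`. Everything here is PROVED;
the definitions (`windowTest`, `wEdge`) are explicit constructions.

The Thorner–Zaman weight of the tree (`TZWeight.tzTest L ε`, a smoothing of the indicator of
`[L/2, L]` in the variable `u = log n`) is the special window `[a, b] = [L/2, L]` of the two-parameter
family built from the same plateau `ψ_{x₀,δ}(t) = smoothTransition((x₀ − t)/δ)` (`DHTest.plateau`):

* `windowTest a b ε u = ψ_{b+ε, ε}(u) · (1 − ψ_{a, ε}(u))` — smooth, `0 ≤ g ≤ 1`, `g = 1` on `[a, b]`,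
  `g = 0` off `(a − ε, b + ε)`; for `0 < ε < a < b` it vanishes near `0` and is an admissible smoothing
  for the exact explicit formulae (`isSmoothedEFTest_windowTest`);
* derivative bounds `|g^{(k)}| ≤ M/ε^k` (`k = 1, 2`), `g^{(k)} = 0` off the two edges
  `(a − ε, a) ∪ (b, b + ε)`, `∫₀^{b+ε} |g^{(k)}| ≤ 2ε · M/ε^k`, with the absolute `M` of
  `TZWeight.exists_smoothTransition_deriv_bound`;
* the Laplace transform `F(w) = ∫₀^∞ g(u) e^{−wu} du`: with
  `E(w) = max(e^{−Re w (a − ε)}, e^{−Re w (b + ε)})` (`wEdge`),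
  `‖F(w)‖ ≤ E(w) · (b − a + 2ε)`, `‖F(w)‖ ≤ E(w) · 2M/‖w‖`, `‖F(w)‖ ≤ E(w) · (2M/ε)/‖w‖²`
  (`norm_fordLaplace_windowTest_le₀`, `norm_fordLaplace_windowTest_le`), and for real arguments the
  sandwich `∫_a^b e^{σu} du ≤ F(−σ) ≤ ∫_{a−ε}^{b+ε} e^{σu} du` (`fordLaplace_windowTest_real_mem`).

With `a = log x`, `b = log(x + h)` this is the weight detecting the prime ideals with norm in the
short interval `(x, x + h]`; the flat bound `b − a + 2ε ≍ h/x` (instead of `L`) and the second-order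
decay are what a Hoheisel-type argument consumes.

## References

* J. Thorner, A. Zaman, ANT 13 (2019), Lemma 2.2 (the weight for `[L/2, L]`). [ThornerZaman2019]
* D. R. Heath-Brown, PLMS 64 (1992), §7 (plateau test functions). [HeathBrown1992PLMS]
* G. Hoheisel, *Primzahlprobleme in der Analysis*, S.-B. Preuss. Akad. Wiss. (1930) 580–588 (short
  intervals from zero density). [folklore]
-/

noncomputable section

open Real MeasureTheory Set Filter Topology intervalIntegral

namespace Literature.NumberTheory.LFunctions.WindowWeight

open Literature.NumberTheory.LFunctions.DHTest Literature.NumberTheory.LFunctions.LaplaceShape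
  Literature.NumberTheory.LFunctions.TZWeight

/-! ### The weight -/

/-- **The window weight** `g(u) = ψ_{b+ε, ε}(u) · (1 − ψ_{a, ε}(u))`: a smooth version of the
indicator of `[a, b]` with transitions of length `ε`. [cite: ThornerZaman2019, Lemma 2.2 (i)–(ii)] -/
def windowTest (a b ε u : ℝ) : ℝ := plateau (b + ε) ε u * (1 - plateau a ε u)

variable {a b ε : ℝ}

/-- `g` is smooth. [folklore] -/
theorem windowTest_contDiff (a b ε : ℝ) (m : ℕ) : ContDiff ℝ m (windowTest a b ε) :=
  (plateau_contDiff _ _ m).mul (contDiff_const.sub (plateau_contDiff _ _ m))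

/-- `g` is continuous. [folklore] -/
theorem windowTest_continuous (a b ε : ℝ) : Continuous (windowTest a b ε) :=
  (windowTest_contDiff a b ε 0).continuous

/-- `0 ≤ g`. [folklore] -/
theorem windowTest_nonneg (a b ε u : ℝ) : 0 ≤ windowTest a b ε u :=
  mul_nonneg (plateau_nonneg _ _ _) (sub_nonneg.2 (plateau_le_one _ _ _))

/-- `g ≤ 1`. [folklore] -/
theorem windowTest_le_one (a b ε u : ℝ) : windowTest a b ε u ≤ 1 := by
  rw [windowTest]
  have h1 := plateau_le_one (b + ε) ε u
  have h2 := plateau_nonneg a ε u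
  have h3 := plateau_nonneg (b + ε) ε u
  have h4 := plateau_le_one a ε u
  nlinarith

/-- `0 ≤ g ≤ 1`. [folklore] -/
theorem windowTest_mem_Icc (a b ε u : ℝ) : windowTest a b ε u ∈ Icc (0 : ℝ) 1 :=
  ⟨windowTest_nonneg _ _ _ _, windowTest_le_one _ _ _ _⟩

/-- `g = 1` on `[a, b]`. [folklore] -/
theorem windowTest_eq_one (hε : 0 < ε) {u : ℝ} (hu1 : a ≤ u) (hu2 : u ≤ b) : windowTest a b ε u = 1 := by
  rw [windowTest, plateau_eq_one hε (by linarith), plateau_eq_zero hε hu1]; ring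

/-- `g = 0` on `(−∞, a − ε]`. [folklore] -/
theorem windowTest_eq_zero_of_le (hε : 0 < ε) {u : ℝ} (hu : u ≤ a - ε) : windowTest a b ε u = 0 := by
  rw [windowTest, plateau_eq_one hε hu]; ring

/-- `g = 0` on `[b + ε, ∞)`. [folklore] -/
theorem windowTest_eq_zero_of_ge (hε : 0 < ε) {u : ℝ} (hu : b + ε ≤ u) : windowTest a b ε u = 0 := by
  rw [windowTest, plateau_eq_zero hε hu]; ring

/-- `g(0) = 0` when `ε ≤ a`. [folklore] -/
theorem windowTest_zero (hε : 0 < ε) (hεa : ε ≤ a) : windowTest a b ε 0 = 0 :=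
  windowTest_eq_zero_of_le hε (by linarith)

/-- On `(−∞, b]` the falling plateau is `1`: `g = 1 − ψ_{a}`. [folklore] -/
theorem windowTest_eq_left (hε : 0 < ε) {u : ℝ} (hu : u ≤ b) :
    windowTest a b ε u = 1 - plateau a ε u := by
  rw [windowTest, plateau_eq_one hε (by linarith)]; ring

/-- On `[a, ∞)` the rising factor is `1`: `g = ψ_{b+ε}`. [folklore] -/
theorem windowTest_eq_right (hε : 0 < ε) {u : ℝ} (hu : a ≤ u) :
    windowTest a b ε u = plateau (b + ε) ε u := by
  rw [windowTest, plateau_eq_zero hε hu]; ring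

/-- **`g` is an admissible smoothing** for the exact explicit formulae (`C^∞`, `= 0` on `[b + ε, ∞)`,
all derivatives vanishing at `b + ε`), for `0 < ε ≤ a ≤ b`. [cite: Ford2002Millennium, Lemma 4.5 (Remark)] -/
theorem isSmoothedEFTest_windowTest (hε : 0 < ε) (hεa : ε ≤ a) (hab : a ≤ b) :
    IsSmoothedEFTest (windowTest a b ε) (windowTest a b ε) (deriv (windowTest a b ε))
      (deriv (deriv (windowTest a b ε))) (b + ε) where
  cont := windowTest_continuous a b ε
  x₀_nonneg := by linarith
  eqOn := fun _ _ ↦ rfl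
  eq_zero := fun _ hu ↦ windowTest_eq_zero_of_ge hε hu
  hasDerivAt := fun t ↦ (((windowTest_contDiff a b ε 1).differentiable (by simp)) t).hasDerivAt
  hasDerivAt' := fun t ↦ by
    have h := (windowTest_contDiff a b ε 2).differentiable_iteratedDeriv' 1
    rw [iteratedDeriv_one] at h
    exact (h t).hasDerivAt
  cont'' := by
    have h := (windowTest_contDiff a b ε 2).continuous_iteratedDeriv 2 le_rfl
    rwa [iteratedDeriv_succ, iteratedDeriv_one] at h
  p_x₀ := windowTest_eq_zero_of_ge hε le_rfl
  p'_x₀ := by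
    have h := iteratedDeriv_eq_zero_of_eq_zero (windowTest_contDiff a b ε)
      (fun u hu ↦ windowTest_eq_zero_of_ge hε hu) 1
    rwa [iteratedDeriv_one] at h

/-! ### Derivatives of `g`: size `M/ε^k` on the two edges, zero elsewhere -/

/-- Near `u < b` the weight is `1 − ψ_{a, ε}`. [folklore] -/
theorem windowTest_eventuallyEq_left (hε : 0 < ε) {u : ℝ} (hu : u < b) :
    windowTest a b ε =ᶠ[𝓝 u] fun v ↦ 1 - plateau a ε v := by
  filter_upwards [Iio_mem_nhds hu] with v hv
  exact windowTest_eq_left hε (le_of_lt hv)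

/-- Near `u > a` the weight is `ψ_{b+ε, ε}`. [folklore] -/
theorem windowTest_eventuallyEq_right (hε : 0 < ε) {u : ℝ} (hu : a < u) :
    windowTest a b ε =ᶠ[𝓝 u] fun v ↦ plateau (b + ε) ε v := by
  filter_upwards [Ioi_mem_nhds hu] with v hv
  exact windowTest_eq_right hε (le_of_lt hv)

/-- **`|g^{(k)}(u)| ≤ M/ε^k`** for `k = 1, 2` and all `u`, and **`g^{(k)}(u) = 0`** off the two edges
`(a − ε, a) ∪ (b, b + ε)` (`a < b`). [folklore] -/
theorem abs_iteratedDeriv_windowTest_le {M : ℝ}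
    (hM : ∀ y : ℝ, |iteratedDeriv 1 Real.smoothTransition y| ≤ M ∧ |iteratedDeriv 2 Real.smoothTransition y| ≤ M)
    (hε : 0 < ε) (hab : a < b) {k : ℕ} (hk : k = 1 ∨ k = 2) (u : ℝ) :
    |iteratedDeriv k (windowTest a b ε) u| ≤ M / ε ^ k ∧
      ((u < a - ε ∨ (a < u ∧ u < b) ∨ b + ε < u) → iteratedDeriv k (windowTest a b ε) u = 0) := by
  have hk0 : 0 < k := by rcases hk with rfl | rfl <;> norm_num
  have hψ : ∀ (x₀ y : ℝ), |iteratedDeriv k (plateau x₀ ε) y| ≤ M / ε ^ k := by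
    intro x₀ y
    rcases hk with rfl | rfl
    · have := (abs_deriv_plateau_le hM x₀ hε y).1
      rwa [iteratedDeriv_one, pow_one]
    · exact (abs_deriv_plateau_le hM x₀ hε y).2
  rcases lt_or_ge u b with hu | hu
  · -- left form
    have hev := (windowTest_eventuallyEq_left (a := a) (ε := ε) hε hu).iteratedDeriv k
    rw [hev.eq_of_nhds, iteratedDeriv_const_sub hk0, iteratedDeriv_neg]
    refine ⟨by rw [abs_neg]; exact hψ _ _, fun hcase ↦ ?_⟩
    rw [neg_eq_zero]
    refine iteratedDeriv_plateau_eq_zero a hε hk ?_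
    rcases hcase with h | ⟨h1, -⟩ | h
    · exact Or.inl h
    · exact Or.inr h1
    · exfalso; linarith
  · -- right form (`u ≥ b > a`)
    have hu' : a < u := lt_of_lt_of_le hab hu
    have hev := (windowTest_eventuallyEq_right (b := b) (ε := ε) hε hu').iteratedDeriv k
    rw [hev.eq_of_nhds]
    refine ⟨hψ _ _, fun hcase ↦ ?_⟩
    refine iteratedDeriv_plateau_eq_zero (b + ε) hε hk ?_
    rcases hcase with h | ⟨-, h2⟩ | h
    · exfalso; linarith
    · exfalso; linarith
    · exact Or.inr h

/-- **`∫₀^{b+ε} |g^{(k)}| ≤ 2ε · M/ε^k`** (`k = 1, 2`; `0 < ε ≤ a < b`): the derivative lives on two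
edges of length `ε`. [folklore] -/
theorem integral_abs_iteratedDeriv_windowTest_le {M : ℝ}
    (hM : ∀ y : ℝ, |iteratedDeriv 1 Real.smoothTransition y| ≤ M ∧ |iteratedDeriv 2 Real.smoothTransition y| ≤ M)
    (hε : 0 < ε) (hεa : ε ≤ a) (hab : a < b) {k : ℕ} (hk : k = 1 ∨ k = 2) :
    ∫ u in (0 : ℝ)..(b + ε), |iteratedDeriv k (windowTest a b ε) u| ≤ 2 * ε * (M / ε ^ k) := by
  set φ := iteratedDeriv k (windowTest a b ε) with hφ
  have hcont : Continuous φ :=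
    (windowTest_contDiff a b ε k).continuous_iteratedDeriv k (by exact_mod_cast le_rfl)
  have hint : ∀ a' b' : ℝ, IntervalIntegrable (fun u ↦ |φ u|) volume a' b' := fun a' b' ↦
    (continuous_abs.comp hcont).intervalIntegrable _ _
  have hb : ∀ u, |φ u| ≤ M / ε ^ k := fun u ↦ (abs_iteratedDeriv_windowTest_le hM hε hab hk u).1
  have hz : ∀ u, (u < a - ε ∨ (a < u ∧ u < b) ∨ b + ε < u) → φ u = 0 :=
    fun u hu ↦ (abs_iteratedDeriv_windowTest_le hM hε hab hk u).2 hu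
  -- split `[0, b+ε]` at `a − ε`, `a`, `b`
  have hsplit : ∫ u in (0 : ℝ)..(b + ε), |φ u| =
      (∫ u in (0 : ℝ)..(a - ε), |φ u|) + (∫ u in (a - ε)..a, |φ u|) +
        (∫ u in a..b, |φ u|) + ∫ u in b..(b + ε), |φ u| := by
    have e1 := intervalIntegral.integral_add_adjacent_intervals (hint 0 (a - ε)) (hint (a - ε) a)
    have e2 := intervalIntegral.integral_add_adjacent_intervals (hint 0 a) (hint a b)
    have e3 := intervalIntegral.integral_add_adjacent_intervals (hint 0 b) (hint b (b + ε))
    linarith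
  rw [hsplit, intervalIntegral_abs_eq_zero (by linarith) (fun t ht ↦ hz t (Or.inl ht.2)),
    intervalIntegral_abs_eq_zero hab.le (fun t ht ↦ hz t (Or.inr (Or.inl ⟨ht.1, ht.2⟩)))]
  have h2 := intervalIntegral_abs_le (φ := φ) (a := a - ε) (b := a) (by linarith) hb
  have h4 := intervalIntegral_abs_le (φ := φ) (a := b) (b := b + ε) (by linarith) hb
  have e2 : (a - (a - ε)) = ε := by ring
  rw [e2] at h2
  have e4 : (b + ε - b) = ε := by ring
  rw [e4] at h4
  linarith

/-! ### The Laplace transform: integration by parts and decay -/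

/-- All derivatives of `g` vanish at `0` (`g = 0` near `0`, since `ε < a`). [folklore] -/
theorem iteratedDeriv_windowTest_zero (hε : 0 < ε) (hεa : ε < a) (j : ℕ) :
    iteratedDeriv j (windowTest a b ε) 0 = 0 := by
  have hloc : windowTest a b ε =ᶠ[𝓝 0] fun _ ↦ (0 : ℝ) := by
    filter_upwards [Iio_mem_nhds (show (0 : ℝ) < a - ε by linarith)] with u hu using
      windowTest_eq_zero_of_le hε (le_of_lt hu)
  rw [hloc.iteratedDeriv_eq j, iteratedDeriv_const]
  rcases j with _ | j <;> simp

/-- The Laplace transform of `g` is the truncated one on `[0, b + ε]` (`0 ≤ b + ε`). [folklore] -/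
theorem fordLaplace_windowTest_eq (hε : 0 < ε) (hb : 0 ≤ b + ε) (w : ℂ) :
    fordLaplace (windowTest a b ε) w = shapeLaplace (windowTest a b ε) (b + ε) w :=
  fordLaplace_eq_intervalIntegral hb (fun _ _ ↦ rfl) (fun _ hu ↦ windowTest_eq_zero_of_ge hε hu)
    (windowTest_continuous a b ε) w

/-- **`k` integrations by parts**: `F(w) = w^{−k} ∫₀^{b+ε} g^{(k)}(u) e^{−wu} du` (`w ≠ 0`,
`0 < ε < a ≤ b`). [cite: ThornerZaman2019, Lemma 2.2 (iv) (decay)] -/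
theorem fordLaplace_windowTest_eq_ibp (hε : 0 < ε) (hεa : ε < a) (hab : a ≤ b) {w : ℂ} (hw : w ≠ 0) (k : ℕ) :
    fordLaplace (windowTest a b ε) w =
      (w ^ k)⁻¹ * shapeLaplace (iteratedDeriv k (windowTest a b ε)) (b + ε) w := by
  rw [fordLaplace_windowTest_eq hε (by linarith), shapeLaplace_eq_sum_add (windowTest_contDiff a b ε)
    (fun u hu ↦ windowTest_eq_zero_of_ge hε hu) hw k]
  simp [iteratedDeriv_windowTest_zero hε hεa]

/-- The size of `e^{−wu}` on the support of `g`: `E(w) = max(e^{−Re w (a − ε)}, e^{−Re w (b + ε)})`.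
[cite: ThornerZaman2019, Lemma 2.2 (iv), (vi)] -/
def wEdge (a b ε : ℝ) (w : ℂ) : ℝ :=
  max (Real.exp (-(w.re * (a - ε)))) (Real.exp (-(w.re * (b + ε))))

/-- `E(w) > 0`. [folklore] -/
theorem wEdge_pos (a b ε : ℝ) (w : ℂ) : 0 < wEdge a b ε w := lt_max_of_lt_left (Real.exp_pos _)

/-- On `[a − ε, b + ε]`: `e^{−Re w · u} ≤ E(w)` (monotonicity of the exponential). [folklore] -/
theorem exp_le_wEdge {w : ℂ} {u : ℝ} (hu1 : a - ε ≤ u) (hu2 : u ≤ b + ε) :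
    Real.exp (-(w.re * u)) ≤ wEdge a b ε w := by
  rw [wEdge]
  rcases le_or_gt 0 w.re with h | h
  · exact le_max_of_le_left (Real.exp_le_exp.2 (by nlinarith))
  · exact le_max_of_le_right (Real.exp_le_exp.2 (by nlinarith))

/-- `E(0) = 1`. [folklore] -/
theorem wEdge_zero (a b ε : ℝ) : wEdge a b ε 0 = 1 := by simp [wEdge]

/-- For `Re w ≤ 0` (in particular `w = −ρ`, `Re ρ ≥ 0`) and `a − ε ≤ b + ε`:
`E(w) = e^{−Re w (b + ε)}`. [folklore] -/
theorem wEdge_eq_of_re_nonpos {w : ℂ} (hw : w.re ≤ 0) (h : a - ε ≤ b + ε) :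
    wEdge a b ε w = Real.exp (-(w.re * (b + ε))) := by
  rw [wEdge]
  exact max_eq_right (Real.exp_le_exp.2 (by nlinarith))

/-- For `Re w ≥ 0` and `a − ε ≤ b + ε`: `E(w) = e^{−Re w (a − ε)}`. [folklore] -/
theorem wEdge_eq_of_re_nonneg {w : ℂ} (hw : 0 ≤ w.re) (h : a - ε ≤ b + ε) :
    wEdge a b ε w = Real.exp (-(w.re * (a - ε))) := by
  rw [wEdge]
  exact max_eq_left (Real.exp_le_exp.2 (by nlinarith))

/-- **The weighted `L¹` bound**: if `φ` vanishes off `[a − ε, b + ε]` (below `a − ε`) and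
`∫₀^{b+ε}|φ| ≤ I`, then `‖∫₀^{b+ε} φ e^{−wu}‖ ≤ E(w) · I` (`0 ≤ b + ε`). [folklore] -/
theorem norm_shapeLaplace_le_wEdge_mul {φ : ℝ → ℝ} (hφc : Continuous φ) (hb : 0 ≤ b + ε)
    (hφ0 : ∀ u, u < a - ε → φ u = 0) {I : ℝ} (hI : ∫ u in (0 : ℝ)..(b + ε), |φ u| ≤ I) (w : ℂ) :
    ‖shapeLaplace φ (b + ε) w‖ ≤ wEdge a b ε w * I := by
  refine (norm_shapeLaplace_le φ hb w).trans ?_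
  have hE := wEdge_pos a b ε w
  calc ∫ u in (0 : ℝ)..(b + ε), |φ u| * Real.exp (-(w.re * u))
      ≤ ∫ u in (0 : ℝ)..(b + ε), |φ u| * wEdge a b ε w := by
        refine intervalIntegral.integral_mono_on hb ?_ ?_ fun u hu ↦ ?_
        · exact ((continuous_abs.comp hφc).mul (by fun_prop)).intervalIntegrable _ _
        · exact ((continuous_abs.comp hφc).mul continuous_const).intervalIntegrable _ _
        · rcases lt_or_ge u (a - ε) with h | h
          · rw [hφ0 u h, abs_zero, zero_mul, zero_mul]
          · exact mul_le_mul_of_nonneg_left (exp_le_wEdge h hu.2) (abs_nonneg _)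
    _ = wEdge a b ε w * ∫ u in (0 : ℝ)..(b + ε), |φ u| := by
        rw [intervalIntegral.integral_mul_const, mul_comm]
    _ ≤ wEdge a b ε w * I := mul_le_mul_of_nonneg_left hI hE.le

/-- **The trivial bound** `‖F(w)‖ ≤ E(w)(b − a + 2ε)` (`0 < ε ≤ a ≤ b`): `g` lives on an interval
of length `b − a + 2ε` and is bounded by `1`. [cite: ThornerZaman2019, Lemma 2.2 (iv)] -/
theorem norm_fordLaplace_windowTest_le₀ (hε : 0 < ε) (hεa : ε ≤ a) (hab : a ≤ b) (w : ℂ) :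
    ‖fordLaplace (windowTest a b ε) w‖ ≤ wEdge a b ε w * (b - a + 2 * ε) := by
  have hb : 0 ≤ b + ε := by linarith
  rw [fordLaplace_windowTest_eq hε hb]
  refine norm_shapeLaplace_le_wEdge_mul (windowTest_continuous a b ε) hb
    (fun u hu ↦ windowTest_eq_zero_of_le hε hu.le) ?_ w
  -- `∫₀^{b+ε} |g| = ∫₀^{a−ε} 0 + ∫_{a−ε}^{b+ε} |g| ≤ (b + ε − (a − ε)) · 1`
  set φ := windowTest a b ε with hφ
  have hcont : Continuous φ := windowTest_continuous a b ε
  have hint : ∀ a' b' : ℝ, IntervalIntegrable (fun u ↦ |φ u|) volume a' b' := fun a' b' ↦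
    (continuous_abs.comp hcont).intervalIntegrable _ _
  have e1 := intervalIntegral.integral_add_adjacent_intervals (hint 0 (a - ε)) (hint (a - ε) (b + ε))
  have hz : ∫ u in (0 : ℝ)..(a - ε), |φ u| = 0 :=
    intervalIntegral_abs_eq_zero (by linarith) (fun t ht ↦ windowTest_eq_zero_of_le hε ht.2.le)
  have hle := intervalIntegral_abs_le (φ := φ) (a := a - ε) (b := b + ε) (C := 1) (by linarith)
    (fun u ↦ by rw [abs_of_nonneg (windowTest_nonneg a b ε u)]; exact windowTest_le_one a b ε u)
  have e2 : (b + ε - (a - ε)) * 1 = b - a + 2 * ε := by ring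
  rw [e2] at hle
  linarith

/-- **The decay bounds**: with the absolute `M` of `TZWeight.exists_smoothTransition_deriv_bound`, for
`w ≠ 0` and `0 < ε < a < b`: `‖F(w)‖ ≤ E(w) · 2M/‖w‖` and `‖F(w)‖ ≤ E(w) · (2M/ε)/‖w‖²`.
[cite: ThornerZaman2019, Lemma 2.2 (iv), (vi)] -/
theorem norm_fordLaplace_windowTest_le {M : ℝ}
    (hM : ∀ y : ℝ, |iteratedDeriv 1 Real.smoothTransition y| ≤ M ∧ |iteratedDeriv 2 Real.smoothTransition y| ≤ M)
    (hε : 0 < ε) (hεa : ε < a) (hab : a < b) {w : ℂ} (hw : w ≠ 0) :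
    ‖fordLaplace (windowTest a b ε) w‖ ≤ wEdge a b ε w * (2 * M) / ‖w‖ ∧
      ‖fordLaplace (windowTest a b ε) w‖ ≤ wEdge a b ε w * (2 * M / ε) / ‖w‖ ^ 2 := by
  have hb : 0 ≤ b + ε := by linarith
  have key : ∀ {k : ℕ}, (k = 1 ∨ k = 2) →
      ‖fordLaplace (windowTest a b ε) w‖ ≤ wEdge a b ε w * (2 * ε * (M / ε ^ k)) / ‖w‖ ^ k := by
    intro k hk
    rw [fordLaplace_windowTest_eq_ibp hε hεa hab.le hw k, norm_mul, norm_inv, norm_pow, mul_comm,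
      ← div_eq_mul_inv]
    refine div_le_div_of_nonneg_right ?_ (by positivity)
    refine norm_shapeLaplace_le_wEdge_mul
      ((windowTest_contDiff a b ε k).continuous_iteratedDeriv k (by exact_mod_cast le_rfl)) hb
      (fun u hu ↦ (abs_iteratedDeriv_windowTest_le hM hε hab hk u).2 (Or.inl hu)) ?_ w
    exact integral_abs_iteratedDeriv_windowTest_le hM hε hεa.le hab hk
  constructor
  · have h := key (Or.inl rfl)
    rw [pow_one, pow_one] at h
    convert h using 2; field_simp
  · have h := key (Or.inr rfl)
    convert h using 2; field_simp

/-- **`‖F(0)‖ ≤ b − a + 2ε`** (`E(0) = 1`). [folklore] -/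
theorem norm_fordLaplace_windowTest_zero_le (hε : 0 < ε) (hεa : ε ≤ a) (hab : a ≤ b) :
    ‖fordLaplace (windowTest a b ε) 0‖ ≤ b - a + 2 * ε := by
  have h := norm_fordLaplace_windowTest_le₀ hε hεa hab 0
  rwa [wEdge_zero, one_mul] at h

/-- **The left-line bound** `‖F(0 − (−1/2 + iy))‖ = ‖F(1/2 − iy)‖ ≤ e^{−(a−ε)/2} (2M/ε)/(1/4 + y²)`
(`0 < ε < a < b`). [folklore] -/
theorem norm_fordLaplace_windowTest_leftLine_le {M : ℝ}
    (hM : ∀ y : ℝ, |iteratedDeriv 1 Real.smoothTransition y| ≤ M ∧ |iteratedDeriv 2 Real.smoothTransition y| ≤ M)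
    (hε : 0 < ε) (hεa : ε < a) (hab : a < b) (y : ℝ) :
    ‖fordLaplace₀ (windowTest a b ε) (0 - (((-(1 / 2) : ℝ) : ℂ) + y * Complex.I))‖ ≤
      (Real.exp (-((a - ε) / 2)) * (2 * M / ε)) / (1 / 4 + y ^ 2) := by
  set w : ℂ := 0 - (((-(1 / 2) : ℝ) : ℂ) + y * Complex.I) with hw
  have hwre : w.re = 1 / 2 := by simp [hw]
  have hwim : w.im = -y := by simp [hw]
  have hw0 : w ≠ 0 := fun h ↦ by have := congrArg Complex.re h; rw [hwre] at this; norm_num at this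
  have h0 : fordLaplace₀ (windowTest a b ε) w = fordLaplace (windowTest a b ε) w := by
    simp [fordLaplace₀, windowTest_zero hε hεa.le]
  rw [h0]
  have h := (norm_fordLaplace_windowTest_le hM hε hεa hab hw0).2
  have hE : wEdge a b ε w = Real.exp (-((a - ε) / 2)) := by
    rw [wEdge_eq_of_re_nonneg (by rw [hwre]; norm_num) (by linarith), hwre]
    congr 1; ring
  have hnorm : ‖w‖ ^ 2 = 1 / 4 + y ^ 2 := by
    rw [Complex.sq_norm, Complex.normSq_apply, hwre, hwim]; ring
  rw [hE, hnorm] at h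
  exact h

/-! ### Real arguments: the main-term sandwiches -/

/-- At a real point the Laplace transform of the real weight is real:
`F(−σ) = ∫₀^{b+ε} g(u) e^{σu} du` (`0 ≤ b + ε`). [folklore] -/
theorem fordLaplace_windowTest_ofReal (hε : 0 < ε) (hb : 0 ≤ b + ε) (σ : ℝ) :
    fordLaplace (windowTest a b ε) (-(σ : ℂ)) =
      ((∫ u in (0 : ℝ)..(b + ε), windowTest a b ε u * Real.exp (σ * u) : ℝ) : ℂ) := by
  rw [fordLaplace_windowTest_eq hε hb, shapeLaplace, ← intervalIntegral.integral_ofReal]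
  refine intervalIntegral.integral_congr fun u _ ↦ ?_
  push_cast
  ring_nf

/-- **The sandwich**: for a continuous `h ≥ 0` and `0 < ε ≤ a ≤ b`,
`∫_a^b h ≤ ∫₀^{b+ε} g·h ≤ ∫_{a−ε}^{b+ε} h`. [cite: ThornerZaman2019, Lemma 2.2 (v) (proof)] -/
theorem sandwich_windowTest {h : ℝ → ℝ} (hc : Continuous h) (h0 : ∀ u, 0 ≤ h u)
    (hε : 0 < ε) (hεa : ε ≤ a) (hab : a ≤ b) :
    (∫ u in a..b, h u) ≤ ∫ u in (0 : ℝ)..(b + ε), windowTest a b ε u * h u ∧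
      (∫ u in (0 : ℝ)..(b + ε), windowTest a b ε u * h u) ≤ ∫ u in (a - ε)..(b + ε), h u := by
  set g := windowTest a b ε with hg
  have hgc : Continuous g := windowTest_continuous a b ε
  have hint : ∀ a' b' : ℝ, IntervalIntegrable (fun u ↦ g u * h u) volume a' b' := fun a' b' ↦
    (hgc.mul hc).intervalIntegrable _ _
  have hinth : ∀ a' b' : ℝ, IntervalIntegrable h volume a' b' := fun a' b' ↦ hc.intervalIntegrable _ _
  have hgh0 : ∀ u, 0 ≤ g u * h u := fun u ↦ mul_nonneg (windowTest_nonneg a b ε u) (h0 u)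
  -- split `[0, b+ε]` as `[0, a−ε] ∪ [a−ε, b+ε]` and note `g h = 0` on the first piece
  have hsplit : ∫ u in (0 : ℝ)..(b + ε), g u * h u = ∫ u in (a - ε)..(b + ε), g u * h u := by
    have e := intervalIntegral.integral_add_adjacent_intervals (hint 0 (a - ε)) (hint (a - ε) (b + ε))
    have hz : ∫ u in (0 : ℝ)..(a - ε), g u * h u = 0 := by
      rw [intervalIntegral.integral_of_le (by linarith)]
      refine setIntegral_eq_zero_of_forall_eq_zero fun u hu ↦ ?_
      rw [hg, windowTest_eq_zero_of_le hε hu.2, zero_mul]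
    linarith
  constructor
  · -- lower bound: restrict to `[a, b]` where `g = 1`
    rw [hsplit]
    have e2 := intervalIntegral.integral_add_adjacent_intervals (hint (a - ε) a) (hint a (b + ε))
    have e3 := intervalIntegral.integral_add_adjacent_intervals (hint a b) (hint b (b + ε))
    have p1 : 0 ≤ ∫ u in (a - ε)..a, g u * h u :=
      intervalIntegral.integral_nonneg (by linarith) fun u _ ↦ hgh0 u
    have p3 : 0 ≤ ∫ u in b..(b + ε), g u * h u :=
      intervalIntegral.integral_nonneg (by linarith) fun u _ ↦ hgh0 u
    have hmid : ∫ u in a..b, g u * h u = ∫ u in a..b, h u := by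
      refine intervalIntegral.integral_congr fun u hu ↦ ?_
      rw [uIcc_of_le hab] at hu
      simp only [hg, windowTest_eq_one hε hu.1 hu.2, one_mul]
    linarith
  · rw [hsplit]
    refine intervalIntegral.integral_mono_on (by linarith) (hint _ _) (hinth _ _) fun u _ ↦ ?_
    calc g u * h u ≤ 1 * h u := mul_le_mul_of_nonneg_right (windowTest_le_one a b ε u) (h0 u)
      _ = h u := one_mul _

/-- **The main term** `F(−σ)` for real `σ`:
`∫_a^b e^{σu} du ≤ Re F(−σ) ≤ ∫_{a−ε}^{b+ε} e^{σu} du` (`0 < ε ≤ a ≤ b`). [cite: ThornerZaman2019, Lemma 2.2 (v)] -/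
theorem fordLaplace_windowTest_real_mem (hε : 0 < ε) (hεa : ε ≤ a) (hab : a ≤ b) (σ : ℝ) :
    (∫ u in a..b, Real.exp (σ * u)) ≤ (fordLaplace (windowTest a b ε) (-(σ : ℂ))).re ∧
      (fordLaplace (windowTest a b ε) (-(σ : ℂ))).re ≤ ∫ u in (a - ε)..(b + ε), Real.exp (σ * u) := by
  rw [fordLaplace_windowTest_ofReal hε (by linarith) σ, Complex.ofReal_re]
  exact sandwich_windowTest (h := fun u ↦ Real.exp (σ * u)) (by fun_prop) (fun u ↦ (Real.exp_pos _).le)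
    hε hεa hab

/-- `F(−σ)` is real for real `σ` (`0 ≤ b + ε`): its imaginary part vanishes. [folklore] -/
theorem fordLaplace_windowTest_real_im (hε : 0 < ε) (hb : 0 ≤ b + ε) (σ : ℝ) :
    (fordLaplace (windowTest a b ε) (-(σ : ℂ))).im = 0 := by
  rw [fordLaplace_windowTest_ofReal hε hb σ, Complex.ofReal_im]

/-- **The main term at `σ = 1` for the window `[log x, log x + η]`**: with `a = log x + ε`,
`b = log x + η − ε` (`0 < 2ε < η`, `x > 0`, `ε ≤ a`) one has
`x (e^{η−ε} − e^{ε}) ≤ Re F(−1) ≤ x (e^{η} − 1)`; with `a = log x`, `b = log x + η`,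
`x (e^{η} − 1) ≤ Re F(−1) ≤ x (e^{η+ε} − e^{−ε})`.  We record the general form
`e^{b} − e^{a} ≤ Re F(−1) ≤ e^{b+ε} − e^{a−ε}`. [folklore] -/
theorem fordLaplace_windowTest_neg_one_mem (hε : 0 < ε) (hεa : ε ≤ a) (hab : a ≤ b) :
    Real.exp b - Real.exp a ≤ (fordLaplace (windowTest a b ε) (-(1 : ℂ))).re ∧
      (fordLaplace (windowTest a b ε) (-(1 : ℂ))).re ≤ Real.exp (b + ε) - Real.exp (a - ε) := by
  have h := fordLaplace_windowTest_real_mem hε hεa hab 1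
  push_cast at h
  simp only [one_mul] at h
  rw [integral_exp, integral_exp] at h
  exact h

end Literature.NumberTheory.LFunctions.WindowWeight

end
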